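import Mathlib
import Summits.CriticalPhenomena.PercolationContinuityZ3.Theorems.PercNearOneGluingNoHeavyLowerTailFatMinorityCaseIStep
import HarnessLib

/-!
# `NoHeavyLowerTail` (stmt-CriticalPhenomena-4575), line fat-minority-linear — the SINGLETON STEP (B2) of the (UT4, QUT4)
# induction (route task `nh-dp-fatminority`, gen 9; PROOF-UT4-upto3ports.md (B2), PROOF-INDUCTION-modulo-C2.md)

Same setting as `…FatMinorityCaseIStep`.  If the singleton `{z}` is a member of the up-set `𝒰` (so `U ⊇ {e open}`, `e = s(o,z)`, and
`U^z = {e open}`), the cells containing `z` contribute EXACTLY `w(e)·(μ₁(c↔b) − μ₁(z↔b))` — no sign condition (no 'Case I') is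
needed — and the Case-I computation goes through verbatim:

`upsetStar_singleton_step`: `{z} ∈ 𝒰`, `μ₁(c↔b) − μ₁(z↔b) ≤ t − E` (`E ≥ 0`), the induction hypothesis in the deleted graph
`μ₀({c↔b} ∩ U) − μ₀({o↔b} ∩ U) ≤ t₀ μ₀(U)` and the threshold bookkeeping `(1 − w e)t₀ ≤ (1 − w e)t + (w e)E` give
`μ({c↔b} ∩ U) − μ({o↔b} ∩ U) ≤ t · μ(U)`.  No new definitions.
-/

namespace Summit.CriticalPhenomena.PercolationContinuityZ3.Theorems

open MeasureTheory Set
open Literature.Probability.LatticeModels (prodBernoulli prodBernoulli_real_setOf_mem prodBernoulli_real_setOf_notMem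
  prodBernoulli_harris_upper_lower prodBernoulli_real_mono_of_isUpperSet)
open Literature.Probability.Percolation

noncomputable section
open scoped Classical

variable {n : ℕ}

/-- **The singleton step (B2) of the (UT4, QUT4) induction.**  See the module docstring.
[cite: KozmaNitzan2024, Lemma 3 p. 6, Lemma 5 p. 13; VandenbergHaggstromKahn2005, Thm. 1.5; reduction: route notes gen 9] -/
theorem upsetStar_singleton_step (w : Sym2 (Fin n) → unitInterval) (A : Finset (Fin n)) (o z c b : Fin n)
    (hoA : o ∉ A) (hzA : z ∈ A) (𝒰 : Finset (Finset (Fin n)))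
    (hsing : ({z} : Finset (Fin n)) ∈ 𝒰) (t E t₀ : ℝ) (hE : 0 ≤ E)
    (hA_hi : (prodBernoulli (Function.update w s(o, z) 1)).real (openConn c b) -
      (prodBernoulli (Function.update w s(o, z) 1)).real (openConn z b) ≤ t - E)
    (ht₀ : (1 - (w s(o, z) : ℝ)) * t₀ ≤ (1 - (w s(o, z) : ℝ)) * t + (w s(o, z) : ℝ) * E)
    (hIH : (prodBernoulli (Function.update w s(o, z) 0)).real (openConn c b ∩ {ω | ∃ B ∈ 𝒰, ∀ u ∈ B, s(o, u) ∈ ω}) -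
        (prodBernoulli (Function.update w s(o, z) 0)).real (openConn o b ∩ {ω | ∃ B ∈ 𝒰, ∀ u ∈ B, s(o, u) ∈ ω}) ≤
      t₀ * (prodBernoulli (Function.update w s(o, z) 0)).real {ω | ∃ B ∈ 𝒰, ∀ u ∈ B, s(o, u) ∈ ω}) :
    (prodBernoulli w).real (openConn c b ∩ {ω | ∃ B ∈ 𝒰, ∀ u ∈ B, s(o, u) ∈ ω}) -
        (prodBernoulli w).real (openConn o b ∩ {ω | ∃ B ∈ 𝒰, ∀ u ∈ B, s(o, u) ∈ ω}) ≤
      t * (prodBernoulli w).real {ω | ∃ B ∈ 𝒰, ∀ u ∈ B, s(o, u) ∈ ω} := by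
  set e : Sym2 (Fin n) := s(o, z) with he
  set μ := prodBernoulli w with hμ
  set μ₁ := prodBernoulli (Function.update w e 1) with hμ₁
  set μ₀ := prodBernoulli (Function.update w e 0) with hμ₀
  set U : Set (BondConfig (Fin n)) := {ω | ∃ B ∈ 𝒰, ∀ u ∈ B, s(o, u) ∈ ω} with hU
  set Uz : Set (BondConfig (Fin n)) := {ω | s(o, z) ∈ ω} ∩ U with hUz
  set p : ℝ := (w e : ℝ) with hp
  have hp0 : 0 ≤ p := (w e).2.1
  have hp1 : p ≤ 1 := (w e).2.2
  have hzo : z ≠ o := fun h => hoA (h ▸ hzA)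
  -- (1) split along the port
  have hsc := real_inter_upEvent_split μ e (openConn c b) U
  have hso := real_inter_upEvent_split μ e (openConn o b) U
  have hsU : μ.real U = μ.real Uz + μ.real (U ∩ {ω | e ∉ ω}) := by
    have h := real_inter_upEvent_split μ e Set.univ U
    simpa only [Set.univ_inter] using h
  -- (2) transfers
  have hUz_open : Uz ⊆ {ω | e ∈ ω} := fun ω hω => hω.1
  have hUz_eq : μ.real Uz = p * μ₁.real Uz := real_of_subset_edgeOpen w e Uz hUz_open
  have hcl_U : μ.real (U ∩ {ω | e ∉ ω}) = (1 - p) * μ₀.real U := by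
    rw [real_of_subset_edgeClosed w e _ (fun ω hω => hω.2), ← real_update_zero_eq_inter_edgeClosed]
  have hcl_c : μ.real (openConn c b ∩ U ∩ {ω | e ∉ ω}) = (1 - p) * μ₀.real (openConn c b ∩ U) := by
    rw [real_of_subset_edgeClosed w e _ (fun ω hω => hω.2), ← real_update_zero_eq_inter_edgeClosed]
  have hcl_o : μ.real (openConn o b ∩ U ∩ {ω | e ∉ ω}) = (1 - p) * μ₀.real (openConn o b ∩ U) := by
    rw [real_of_subset_edgeClosed w e _ (fun ω hω => hω.2), ← real_update_zero_eq_inter_edgeClosed]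
  -- (3) bracket on the cells containing z: X ≤ p μ₁(Uz) (μ₁(cb) − μ₁(zb))
  set X := μ.real (openConn c b ∩ Uz) - μ.real (openConn o b ∩ Uz) with hX
  set A' := μ₁.real (openConn c b) - μ₁.real (openConn z b) with hA'
  have hXle : X ≤ p * μ₁.real Uz * A' := by
    -- `{z} ∈ 𝒰`: `Uz = {e open}`, `μ₁(Uz) = 1`, and the cells containing `z` contribute exactly `p · A'`
    have hUz_all : Uz = {ω | e ∈ ω} := by
      refine Set.Subset.antisymm hUz_open fun ω hω => ⟨hω, {z}, hsing, fun u hu => ?_⟩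
      rw [Finset.mem_singleton] at hu; subst hu; exact hω
    have hμ₁Uz : μ₁.real Uz = 1 := by
      rw [hUz_all, hμ₁, prodBernoulli_real_setOf_mem, Function.update_self]; rfl
    have hc : μ.real (openConn c b ∩ Uz) = p * μ₁.real (openConn c b ∩ Uz) :=
      real_of_subset_edgeOpen w e _ (fun ω hω => hUz_open hω.2)
    have ho : μ.real (openConn o b ∩ Uz) = p * μ₁.real (openConn z b ∩ Uz) := by
      rw [hUz, openConn_inter_edgeOpen_eq hzo b]
      exact real_of_subset_edgeOpen w e _ (fun ω hω => hUz_open hω.2)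
    have hc1 : μ₁.real (openConn c b ∩ Uz) = μ₁.real (openConn c b) := by
      rw [hUz_all]; exact (real_update_one_eq_inter_edgeOpen w e _).symm
    have hz1 : μ₁.real (openConn z b ∩ Uz) = μ₁.real (openConn z b) := by
      rw [hUz_all]; exact (real_update_one_eq_inter_edgeOpen w e _).symm
    rw [hX, hc, ho, hc1, hz1, hμ₁Uz, hA']
    linarith
  -- (4) the cells avoiding z: induction hypothesis in the deleted graph
  have hoff : μ.real (openConn c b ∩ U ∩ {ω | e ∉ ω}) - μ.real (openConn o b ∩ U ∩ {ω | e ∉ ω}) ≤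
      (1 - p) * t₀ * μ₀.real U := by
    rw [hcl_c, hcl_o]
    have h1p : 0 ≤ 1 - p := by linarith
    nlinarith [hIH, h1p]
  -- (5) monotonicity μ₀(U) ≤ μ₁(U) = μ₁(Uz)
  have hmono : μ₀.real U ≤ μ₁.real Uz := by
    have h1 : μ₀.real U ≤ μ₁.real U :=
      prodBernoulli_real_mono_of_isUpperSet (update_zero_le_update_one w e) (isUpperSet_starUpEvent o 𝒰)
        MeasurableSet.of_discrete
    have h2 : μ₁.real U = μ₁.real Uz := by
      rw [hUz, Set.inter_comm]; exact real_update_one_eq_inter_edgeOpen w e U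
    linarith
  -- (6) assemble
  rw [hsc, hso, hsU, hUz_eq, hcl_U]
  have hU0 : 0 ≤ μ₀.real U := measureReal_nonneg
  have hUz0 : 0 ≤ μ₁.real Uz := measureReal_nonneg
  have hkey : X + (μ.real (openConn c b ∩ U ∩ {ω | e ∉ ω}) - μ.real (openConn o b ∩ U ∩ {ω | e ∉ ω})) ≤
      t * (p * μ₁.real Uz + (1 - p) * μ₀.real U) := by
    have h1 : X ≤ p * μ₁.real Uz * (t - E) :=
      hXle.trans (mul_le_mul_of_nonneg_left hA_hi (mul_nonneg hp0 hUz0))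
    have h2 : (1 - p) * t₀ * μ₀.real U ≤ ((1 - p) * t + p * E) * μ₀.real U :=
      mul_le_mul_of_nonneg_right ht₀ hU0
    nlinarith [h1, h2, hoff, hmono, hE, hp0, mul_nonneg hp0 hE]
  linarith [hkey]

end

end Summit.CriticalPhenomena.PercolationContinuityZ3.Theorems
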